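import Summits.ResolutionOfSingularities.ResolutionOfSingularities.Theorems.WildQuotientsSummitReductionStubPairOrbitNormalFormBlowupChartsOverCentreLemmas
import Summits.ResolutionOfSingularities.ResolutionOfSingularities.Theorems.WildQuotientsSummitReductionStubPairOrbitNormalFormBlowupSingularOverCentre
import Literature.AlgebraicGeometry.Resolution.AlterationsNormalFormBlowupChartsFormal
import HarnessLib

/-!
# `WildQuotients.SummitReduction` (stmt-ResolutionOfSingularities-16324), line `FramePerfect`, stub O3
# (`stub_pair_orbitNormalFormBlowup_chartsOverCentre`): fields 4.25 (i)/(ii) upstairs at the closed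
# points over the orbit centre, FROM the chart computation on the coefficient-free model (1/2)

Route `ResolutionOfSingularities/WildQuotients`, crux `SummitReduction`; helper file of the line
skeleton (v9–v10), stub O3 = de Jong 1996, 4.27 [C2] for `DeJong1997.QuasiSplitNormalFormPair`
(de Jong 1997, 5.11 ¶3: "The resulting scheme has a local description as above by the computations
of [1, 4.27]"). The printed proof (de Jong 1996, p. 76) computes the charts of the blow-up of
"the scheme `Spec k⟦u, v, t₁, …, t_{d-1}⟧/(uv - t₁ ⋯ t_s)` in the ideal `(u, v, t₁, t₂)`", i.e. of
the blow-up BASE-CHANGED to a formal model of `𝒪_{X,x}` at the point `x = π(x')` of the centre.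
This file REDUCES the stub to that single model-level statement (hypothesis `hNB2`, the sub-goal
"NB2"; compare the S worker's `stub_pair_orbitNormalFormBlowup_singularOverCentre_of_model` for
[C1]): for a regular local ring `A` with regular system of parameters `t`, `2 ≤ s ≤ r ≤ m`,
`a₀ < b₀ < s`, the model `M = A⟦u, v⟧/(uv - ∏_{i<s} tᵢ)`, ANY blow-up `ρ₁ : B → Spec M` in
`𝔭 = (t_{a₀}, t_{b₀}) M + (u, v)` and any closed point `y` of `B` over the closed point: the
exceptional ideal `𝔭 𝒪_{B,y}` is generated by a non-zero-divisor `G`, the boundary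
`(∏_{i<r} tᵢ) 𝒪_{B,y}` is `(G² w)` with `√((G² w) 𝒪̂_{B,y}) = (G w) 𝒪̂_{B,y}` (the boundary passes
doubly through the exceptional divisor), `(G w)` has local strict normal crossings data if
`𝒪_{B,y}` is regular, and `(𝒪̂_{B,y}, (G w)) ≅ (A'⟦u, v⟧/(uv - ∏_{i<s'} t'ᵢ), (∏_{i<r'} t'ᵢ))` for
a new regular local `A'` of dimension `m`, `2 ≤ s' ≤ r' ≤ m`, if not.

This first file of the reduction sets up, at ONE closed point `x'` over the centre, the passage to
the model (`chartsOverCentre_point_transfer`): the model `e : 𝒪̂_{X,x} ≅ M` with the dictionary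
`e(Î_C) = 𝔭`, `e(Î_Z) = (∏_{i<r} tᵢ)` (`quasiSplitNormalFormPair_centreFormalIdeal(_orbit)`), and
the transfer to the base change `B = π⁻¹(U) ×_U Spec M` (`chartsOverCentre_transfer`:
`Γ(X, U) → 𝒪_{X,x} → 𝒪̂_{X,x} ≅ M` is flat and bijective on the levels of the maximal ideal of the
closed point `x`), a blow-up of `Spec M` in `𝔭` with a closed point `y` over `x'` and the closed
point, `𝒪̂_{X',x'} ≅ 𝒪̂_{B,y}`, and the stalk ideals of `π⁻¹ Z`, `π⁻¹ C` carried to those of the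
model boundary and centre. The sibling file `…ChartsOverCentreReduction2` concludes.

## Sources

* A. J. de Jong, *Smoothness, semi-stability and alterations*, Publ. Math. IHÉS 83 (1996), 4.25–4.27,
  pp. 75–76. [DeJong1996]
* A. J. de Jong, *Families of curves and alterations*, Ann. Inst. Fourier 47 (1997), proof of
  Prop. 5.11, p. 619. [DeJong1997]
* H. Matsumura, *Commutative Ring Theory* (1986), Thm. 7.5, 8.11, 23.7. [Matsumura1987]
-/

set_option linter.dupNamespace false -- the tree's summit namespace repeats `ResolutionOfSingularities`

noncomputable section

open CategoryTheory CategoryTheory.Limits AlgebraicGeometry TopologicalSpace Topology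
open Literature.AlgebraicGeometry.Resolution
open Literature.AlgebraicGeometry
open IsLocalRing Scheme.IdealSheafData

namespace Summit.ResolutionOfSingularities.ResolutionOfSingularities.Theorems

/-! ## The transfer package at one closed point over the centre -/

/-- **The transfer package at a closed point `x'` of `X'` over the orbit centre.** With
`x = π(x')` (closed and singular): the model `e : 𝒪̂_{X,x} ≅ M = A⟦u, v⟧/(uv - ∏_{i<s} tᵢ)` of
field 4.25 (ii) carries `Î_Z` to `(∏_{i<r} tᵢ)` and the completed ideal of the centre (near `x`
the translate of `E` through `x`) to `𝔭 = (t_{a₀}, t_{b₀}) + (u, v)`, `a₀ < b₀ < s`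
(`quasiSplitNormalFormPair_centreFormalIdeal`, `…_orbit`); over an affine open `U ∋ x` the
algebra `Γ(X, U) → 𝒪_{X,x} → 𝒪̂_{X,x} ≅ M` is flat and bijective on all levels of the maximal
ideal of `x`, and the closed point of `Spec M` lies over `x`; so `chartsOverCentre_transfer`
yields the base change `ρ₁ : B → Spec M` — a blow-up in `𝔭` (the inverse image of an ideal sheaf
along `Spec M → Spec 𝒪_{X,x} → X` being the ideal sheaf of its completed stalk,
`comap_SpecMap_comp_fromSpecStalk_eq_ofIdealTop`) — with a closed point `y` over `x'` and over the
closed point of `M`, `𝒪_{X',x'}` regular iff `𝒪_{B,y}` regular, an isomorphism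
`Ξ : 𝒪̂_{X',x'} ≅ 𝒪̂_{B,y}` extending `φ : 𝒪_{X',x'} → 𝒪_{B,y}`, and `φ` carrying the stalks at
`x'` of the ideals of `π⁻¹ Z`, `π⁻¹ C` onto the stalks at `y` of the inverse images of
`(∏_{i<r} tᵢ)~` and `𝔭~`. [cite: DeJong1996, 4.27, pp. 75–76] [cite: DeJong1997, proof of Prop. 5.11, p. 619] -/
theorem chartsOverCentre_point_transfer {k : Type} [Field k] {X X' : Scheme.{0}}
    {p : X ⟶ Spec (.of k)} {Z : Set X} {G : Type} [Group G] [Finite G] {ρ : G →* Aut X} {d : ℕ}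
    (hP : DeJong1997.QuasiSplitNormalFormPair p Z ρ d)
    {E : Set ↥({x : X | ¬ IsRegularLocalRing (X.presheaf.stalk x)} : Set X)}
    (hE : E ∈ irreducibleComponents ↥({x : X | ¬ IsRegularLocalRing (X.presheaf.stalk x)} : Set X))
    {π : X' ⟶ X}
    (hπ : IsBlowup π (vanishingIdeal
      ⟨closure (⋃ g : G, (ρ g).hom.base '' (Subtype.val '' E)), isClosed_closure⟩))
    [LocallyOfFiniteType π]
    {x' : X'} (hx'c : IsClosed ({x'} : Set X'))
    (hx : π.base x' ∈ closure (⋃ g : G, (ρ g).hom.base '' (Subtype.val '' E))) :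
    ∃ (A : Type) (_ : CommRing A) (_ : IsRegularLocalRing A) (t : Fin (d - 1) → A) (s r : ℕ)
      (_ : Ideal.span (Set.range t) = IsLocalRing.maximalIdeal A) (_ : ringKrullDim A = (d - 1 : ℕ))
      (_ : 2 ≤ s) (_ : s ≤ r) (_ : r ≤ d - 1) (a₀ b₀ : Fin (d - 1)) (_ : a₀ < b₀) (_ : b₀.val < s)
      (B : Scheme.{0}) (ρ₁ : B ⟶ Spec (.of (DeJong1996.NodeDeformationRing A
          (∏ i ∈ Finset.univ.filter (fun i : Fin (d - 1) => i.val < s), t i)))) (y : B)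
      (φ : X'.presheaf.stalk x' →+* B.presheaf.stalk y)
      (Ξ : AdicCompletion (IsLocalRing.maximalIdeal (X'.presheaf.stalk x')) (X'.presheaf.stalk x') ≃+*
        AdicCompletion (IsLocalRing.maximalIdeal (B.presheaf.stalk y)) (B.presheaf.stalk y)),
      IsBlowup ρ₁ (Scheme.IdealSheafData.ofIdealTop
          ((((Ideal.span {t a₀, t b₀}).map (DeJong1996.NodeDeformationRing.ofBase A _) ⊔
              Ideal.span {Ideal.Quotient.mk _ (MvPowerSeries.X 0),
                Ideal.Quotient.mk _ (MvPowerSeries.X 1)})).map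
            (Scheme.ΓSpecIso (.of (DeJong1996.NodeDeformationRing A
              (∏ i ∈ Finset.univ.filter (fun i : Fin (d - 1) => i.val < s), t i)))).inv.hom)) ∧
      IsClosed ({y} : Set B) ∧ (∀ f, f ∈ (ρ₁.base y).asIdeal ∨ IsUnit f) ∧
      (IsRegularLocalRing (X'.presheaf.stalk x') ↔ IsRegularLocalRing (B.presheaf.stalk y)) ∧
      (∀ a, Ξ (algebraMap _ _ a) = algebraMap _ _ (φ a)) ∧
      (stalkIdeal ((vanishingIdeal ⟨Z, hP.isClosed⟩).comap π) x').map φ =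
        stalkIdeal ((Scheme.IdealSheafData.ofIdealTop
          ((Ideal.span {DeJong1996.NodeDeformationRing.ofBase A _
              (∏ i ∈ Finset.univ.filter (fun i : Fin (d - 1) => i.val < r), t i)}).map
            (Scheme.ΓSpecIso (.of (DeJong1996.NodeDeformationRing A
              (∏ i ∈ Finset.univ.filter (fun i : Fin (d - 1) => i.val < s), t i)))).inv.hom)).comap ρ₁) y ∧
      (stalkIdeal ((vanishingIdeal ⟨closure (⋃ g : G, (ρ g).hom.base '' (Subtype.val '' E)),
          isClosed_closure⟩).comap π) x').map φ = stalkIdeal ((Scheme.IdealSheafData.ofIdealTop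
          ((((Ideal.span {t a₀, t b₀}).map (DeJong1996.NodeDeformationRing.ofBase A _) ⊔
              Ideal.span {Ideal.Quotient.mk _ (MvPowerSeries.X 0),
                Ideal.Quotient.mk _ (MvPowerSeries.X 1)})).map
            (Scheme.ΓSpecIso (.of (DeJong1996.NodeDeformationRing A
              (∏ i ∈ Finset.univ.filter (fun i : Fin (d - 1) => i.val < s), t i)))).inv.hom)).comap ρ₁) y := by
  have hS := hP.isClosed_setOf_not_isRegularLocalRing
  haveI := hP.isIntegral
  haveI := hP.locallyOfFiniteType
  haveI : IsNoetherian X := hP.isNoetherian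
  haveI : IsProper π := hπ.isProper
  haveI : IsLocallyNoetherian X' := LocallyOfFiniteType.isLocallyNoetherian (π ≫ p)
  haveI : IsIntegral X' := hπ.isIntegral (hP.vanishingIdeal_orbit_ne_bot E)
  -- the closed singular point `x = π x'`
  have hxc : IsClosed ({π.base x'} : Set X) := by
    have := π.isClosedMap _ hx'c
    rwa [Set.image_singleton] at this
  have hxS : ¬ IsRegularLocalRing (X.presheaf.stalk (π.base x')) := hP.closure_orbit_subset E hx
  -- the model at `x` and the dictionary
  obtain ⟨A, _, _, t, s, r, hspan, hdim, hs2, hsr, hrd, e, hZ, hdict, -⟩ :=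
    quasiSplitNormalFormPair_centreFormalIdeal hP hxc hxS
  obtain ⟨T, hT, hxT, -, -, hTcompl⟩ := quasiSplitNormalFormPair_centreFormalIdeal_orbit hP hE hx
  obtain ⟨a₀, b₀, hab₀, hb₀s, hcentreT⟩ := hdict T hT hxT
  -- rings and the flat local map `c : 𝒪_{X,x} → 𝒪̂_{X,x} ≅ M`
  let O : CommRingCat.{0} := X.presheaf.stalk (π.base x')
  let Ô := AdicCompletion (maximalIdeal O) O
  let M := DeJong1996.NodeDeformationRing A
    (∏ i ∈ Finset.univ.filter (fun i : Fin (d - 1) => i.val < s), t i)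
  let c : O →+* M := (e : Ô →+* M).comp (algebraMap O Ô)
  have hcflat : c.Flat :=
    RingHom.Flat.comp (RingHom.flat_algebraMap_iff.mpr (AdicCompletion.flat_of_isNoetherian _))
      (RingHom.Flat.of_bijective e.bijective)
  haveI : IsLocalHom c := by
    change IsLocalHom ((e : Ô →+* M).comp (algebraMap O Ô))
    infer_instance
  haveI : Nontrivial M := e.injective.nontrivial
  haveI : IsLocalRing M := IsLocalRing.of_surjective' (e : Ô →+* M) e.surjective
  haveI : IsNoetherianRing Ô := isNoetherianRing_adicCompletion_maximalIdeal O
  haveI : IsNoetherianRing M := isNoetherianRing_of_ringEquiv Ô e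
  -- completed stalk ideals through `c`
  have hmapc : ∀ (T : Closeds X) (U : X.affineOpens) (hU : π.base x' ∈ (U : X.Opens)),
      (stalkIdeal (vanishingIdeal T) (π.base x')).map c =
        (completedStalkIdeal (vanishingIdeal T) (π.base x') U hU).map e.toRingHom := by
    intro T U hU
    rw [completedStalkIdeal_eq_map_stalkIdeal, Ideal.map_map]
    rfl
  -- an affine open `U ∋ x` and the `Γ(X, U)`-algebra `M`
  obtain ⟨U, hU, hxU, -⟩ :=
    exists_isAffineOpen_mem_and_subset (X := X) (x := π.base x') (U := ⊤) (Opens.mem_top _)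
  have hcentre' : (stalkIdeal (vanishingIdeal ⟨closure (⋃ g : G, (ρ g).hom.base '' (Subtype.val '' E)),
      isClosed_closure⟩) (π.base x')).map c =
      ((Ideal.span {t a₀, t b₀}).map (DeJong1996.NodeDeformationRing.ofBase A _) ⊔
        Ideal.span {Ideal.Quotient.mk _ (MvPowerSeries.X 0), Ideal.Quotient.mk _ (MvPowerSeries.X 1)}) := by
    rw [hmapc _ ⟨U, hU⟩ hxU, hTcompl ⟨U, hU⟩ hxU, hcentreT ⟨U, hU⟩ hxU]
  have hZ' : (stalkIdeal (vanishingIdeal ⟨Z, hP.isClosed⟩) (π.base x')).map c =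
      Ideal.span {DeJong1996.NodeDeformationRing.ofBase A _
        (∏ i ∈ Finset.univ.filter (fun i : Fin (d - 1) => i.val < r), t i)} := by
    rw [hmapc _ ⟨U, hU⟩ hxU, hZ ⟨U, hU⟩ hxU]
  -- algebra structures: `Γ(X, U) → 𝒪_{X,x} → 𝒪̂_{X,x} → M`
  letI algUO : Algebra Γ(X, U) O := TopCat.Presheaf.algebra_section_stalk X.presheaf ⟨π.base x', hxU⟩
  haveI hlocO : IsLocalization.AtPrime (O : Type) (hU.primeIdealOf ⟨π.base x', hxU⟩).asIdeal :=
    hU.isLocalization_stalk ⟨π.base x', hxU⟩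
  letI algÔM : Algebra Ô M := (e : Ô →+* M).toAlgebra
  letI algUM : Algebra Γ(X, U) M := ((algebraMap Ô M).comp (algebraMap Γ(X, U) Ô)).toAlgebra
  haveI : IsScalarTower Γ(X, U) Ô M := IsScalarTower.of_algebraMap_eq (fun _ => rfl)
  have halgUM : algebraMap Γ(X, U) M = c.comp (X.presheaf.germ U (π.base x') hxU).hom := rfl
  set 𝔭 := hU.primeIdealOf ⟨π.base x', hxU⟩ with h𝔭def
  haveI h𝔭max : 𝔭.asIdeal.IsMaximal := hU.primeIdealOf_isMaximal_of_isClosed ⟨π.base x', hxU⟩ hxc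
  -- level-bijectivity of `Γ(X, U) → M`
  have hlev : ∀ n, Function.Bijective (Ideal.quotientMap ((𝔭.asIdeal ^ n).map (algebraMap Γ(X, U) M))
      (algebraMap Γ(X, U) M) Ideal.le_comap_map) := by
    have h1 : ∀ n, Function.Bijective (Ideal.quotientMap ((𝔭.asIdeal ^ n).map (algebraMap Γ(X, U) O))
        (algebraMap Γ(X, U) O) Ideal.le_comap_map) := fun n =>
      quotientMap_pow_bijective_of_isLocalization 𝔭.asIdeal O n
    have hmO : 𝔭.asIdeal.map (algebraMap Γ(X, U) O) = maximalIdeal O :=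
      IsLocalization.AtPrime.map_eq_maximalIdeal 𝔭.asIdeal O
    have h2 : ∀ n, Function.Bijective (Ideal.quotientMap
        (((𝔭.asIdeal.map (algebraMap Γ(X, U) O)) ^ n).map (algebraMap O Ô))
        (algebraMap O Ô) Ideal.le_comap_map) := by
      rw [hmO]
      exact quotientMap_pow_bijective_adicCompletion (maximalIdeal O)
        (maximalIdeal O).fg_of_isNoetherianRing
    have h12 := quotientMap_pow_bijective_trans 𝔭.asIdeal h1 h2
    have h3 : ∀ n, Function.Bijective (Ideal.quotientMap
        (((𝔭.asIdeal.map (algebraMap Γ(X, U) Ô)) ^ n).map (algebraMap Ô M))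
        (algebraMap Ô M) Ideal.le_comap_map) := fun n =>
      chartsOverCentre_quotientMap_bijective_of_bijective e.bijective _
    exact quotientMap_pow_bijective_trans 𝔭.asIdeal h12 h3
  -- flatness of `Γ(X, U) → M`
  have hflat : (algebraMap Γ(X, U) M).Flat := by
    rw [halgUM]
    refine RingHom.Flat.comp ?_ hcflat
    have : Module.Flat Γ(X, U) O := IsLocalization.flat O 𝔭.asIdeal.primeCompl
    exact RingHom.flat_algebraMap_iff.mpr this
  -- the closed point of `Spec M` lies over `x`
  have hz : (Spec.map (CommRingCat.ofHom (algebraMap Γ(X, U) M))).base (closedPoint M) = 𝔭 := by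
    rw [halgUM, CommRingCat.ofHom_comp, Spec.map_comp, Scheme.Hom.comp_base, TopCat.comp_app,
      CommRingCat.ofHom_hom]
    have : (Spec.map (CommRingCat.ofHom c)).base (closedPoint M) = closedPoint O := Spec_closedPoint
    rw [this, h𝔭def, hU.primeIdealOf_eq_map_closedPoint ⟨π.base x', hxU⟩]
  -- the transfer
  obtain ⟨B, ρ₁, y, φ, Ξ, hρy, hyc, hblow, hregiff, hΞ, hideal⟩ :=
    chartsOverCentre_transfer π x' ⟨U, hU⟩ hxU M hflat hlev (closedPoint M) hz
  -- the pulled-back ideal sheaves are those of the model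
  have hSpec : Spec.map (CommRingCat.ofHom (algebraMap Γ(X, U) M)) ≫ hU.fromSpec =
      Spec.map (CommRingCat.ofHom c) ≫ X.fromSpecStalk (π.base x') := by
    rw [← hU.fromSpecStalk_eq_fromSpecStalk hxU, IsAffineOpen.fromSpecStalk, halgUM,
      CommRingCat.ofHom_comp, Spec.map_comp, Category.assoc, CommRingCat.ofHom_hom]
  have hcomapI : ∀ I : X.IdealSheafData,
      I.comap (Spec.map (CommRingCat.ofHom (algebraMap Γ(X, U) M)) ≫ hU.fromSpec) =
        Scheme.IdealSheafData.ofIdealTop (((stalkIdeal I (π.base x')).map c).map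
          (Scheme.ΓSpecIso (.of M)).inv.hom) := by
    intro I
    rw [hSpec]
    exact comap_SpecMap_comp_fromSpecStalk_eq_ofIdealTop (π.base x') I (CommRingCat.ofHom c)
  -- the base-changed blow-up is a blow-up of the model in the centre ideal `𝔭_{a₀b₀}`
  have hB := hblow _ hπ
  rw [hcomapI, hcentre'] at hB
  have hρy' : ∀ f : M, f ∈ (ρ₁.base y).asIdeal ∨ IsUnit f := by
    intro f
    by_cases hf : IsUnit f
    · exact Or.inr hf
    · left
      rw [hρy]
      exact hf
  refine ⟨A, _, ‹_›, t, s, r, hspan, hdim, hs2, hsr, hrd, a₀, b₀, hab₀, hb₀s, B, ρ₁, y, φ, Ξ, hB,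
    hyc hx'c, hρy', hregiff, hΞ, ?_, ?_⟩
  · rw [hideal, hcomapI, hZ']
  · rw [hideal, hcomapI, hcentre']

end Summit.ResolutionOfSingularities.ResolutionOfSingularities.Theorems

end
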